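import Mathlib
import Summits.KontsevichZagierPeriods.Zeta5Search.ProfileA6u47CellsA
import Summits.KontsevichZagierPeriods.Zeta5Search.ProfileA6u47CellsB
import Summits.KontsevichZagierPeriods.Zeta5Search.DenomLaw.Profile15aPath
import Summits.KontsevichZagierPeriods.Zeta5Search.DenomLaw.PathWeightProfile
import Summits.KontsevichZagierPeriods.Zeta5Search.DenomLaw.VGainPalCoverKit
import HarnessLib

/-!
# ζ(5) search — the a = 6 profile with long pair blocks `(i,7)` and the pairs within `{4,5,6}`, for EVERY sorted parameter vector at depth `d < 2p`: the V-gain with palindromic rows (DENOM-LAW D1, prover-d1 gen 23)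

Cell `pub-zeta5` (HONEST FRAMING: systematic search; no irrationality claim unless certified), TRACK «DENOM-LAW» D1 prover seat (denom-prover-d1
gen 23, `HOME/denom-law/prover-d1/ATTEMPT-23.md`).  Third a = 6 profile (after `ProfileA6TopPath`): A6U47 = six long parameters
`b₇ < p ≤ b₆`, long pair blocks exactly the `(i,7)` and `(4,5),(4,6),(5,6)` (ORDER conditions `p + b₁ + b₇ ≤ b₀`, `p + b₄ + b₅ ≤ b₀`, `b₀ < p + b₃ + b₆`;
1,852 of the 26,431 a = 6 instances at p = 7; `N_p = 9`, `C⋆ ≤ 8`, node `⌊d/p⌋ − 6` at `⌊d/p⌋ ≤ 1`).  The minimum `VB = −6` of `ν` is again carried only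
by the centre-free palindromic single `[0,−6,0]`, but the deepest multipole type `[1,−3,−3,1]` has `E = −4`, so THEOREM LB's plain row `3 + E = −1`
would give only `−6` at `p ≤ d`; the type is DROPPED (centre-free, palindromic, `3 + E` odd), its LB♯ row is `4 + E = 0`, and gen 23's
`DenomLaw.vgainPal_of_cover` (`VGainPalCoverKit`: the V-gain `V`-bounds with gen 19's palindromic rows, `N = 6`, `R = 0`) gives `v_p(Cas_j(b)) ≥ −5`
at every depth = the node at `⌊d/p⌋ ≤ 1`.  Covers `FullProfile.coverA6U47_ev/od` (`ProfileA6u47Cells{A,B}`, data-driven generator spec `A6U47`,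
all leaf lemmas reused).  Results: `pathAccounting_profileA6u47`, `pathAccountingFirstPeriod_profileA6u47` (binders + `b₇ < p ≤ b₆` + order
conditions + `d < 2p`).  MODEL/structure-side valuation bookkeeping of the cell's own rationals; nothing about ζ(5); no γ; records in print UNMOVED.
-/

open Finset

namespace Summit.KontsevichZagierPeriods.Zeta5Search.FullProfile

open Summit.KontsevichZagierPeriods.Zeta5Search.ClusterValuation
open Summit.KontsevichZagierPeriods.Zeta5Search.CasoratianValuation (InPolytope shift casoratian pairFloors refund)
open Summit.KontsevichZagierPeriods.Zeta5Search.WedgeDictionary (dOf)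
open Summit.KontsevichZagierPeriods.Zeta5Search.ClassTypeCover
open Summit.KontsevichZagierPeriods.Zeta5Search.DenomLaw (cStar FirstPeriod Sorted7 vgainPal_of_cover)
open Summit.KontsevichZagierPeriods.Zeta5Search.DenomLaw.FirstPeriodKit (sorted7_chain firstPeriod_pair pairFloors_expand)
open Summit.KontsevichZagierPeriods.Zeta5Search.SortedProfile

/-! ## The a = 6 profile with long pair blocks `(i,7)`, `i ≤ 6`, and the pairs within `{4,5,6}` -/

section A6U47

variable {b : ℕ → ℤ} {j p : ℕ}

/-- **`C⋆ ≤ 8` on this profile** (six long parameters; long pair blocks `(i,7)`, `i ≤ 6`, and the pairs within `{4,5,6}`): the finite check over the 5,040 orderings (`decide +kernel`). -/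
theorem cStar_le_eight_A6u47 {b : ℕ → ℤ} {p : ℕ} (hs : Sorted7 b) (hA : b 7 < (p : ℤ)) (hQ : b 0 < (p : ℤ) + b 3 + b 6) : cStar b p ≤ 8 := by
  obtain ⟨h21, h32, h43, h54, h65, h76⟩ := sorted7_chain hs
  refine DenomLaw.FirstPeriodKit.cStar_le_of_profile (fun i => i.val ≤ 5)
    (fun i k => ¬ (((i.val ≤ 5 ∧ k.val ≤ 5) ∧ (i.val ≤ 2 ∨ k.val ≤ 2)) ∧ i.val ≠ k.val)) 8 ?_ ?_ (by decide +kernel)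
  · intro i h
    have := i.isLt
    by_contra hc
    have h6 : i.val = 6 := by omega
    have : b (i.val + 1) = b 7 := by rw [h6]
    linarith
  · intro i k hik h
    obtain ⟨⟨⟨hi, hk⟩, hik3⟩, hne⟩ := h
    have := i.isLt; have := k.isLt
    exfalso
    rcases hik3 with h3 | h3 <;> interval_cases hv : i.val <;> interval_cases hw : k.val <;> simp only [Nat.reduceAdd] at hik <;> omega

/-- **`N_p = 9`** on this profile: the pair digits of the 12 short blocks are `0`, the other 9 are `1`. -/
theorem pairFloors_eq_A6u47 (hb : InPolytope b) (hs : Sorted7 b) (hp : 0 < p) (hQ17 : (p : ℤ) + b 1 + b 7 ≤ b 0) (hQ45 : (p : ℤ) + b 4 + b 5 ≤ b 0) (hQ : b 0 < (p : ℤ) + b 3 + b 6) (hfp : FirstPeriod b p) : pairFloors b p = 9 := by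
  obtain ⟨h21, h32, h43, h54, h65, h76⟩ := sorted7_chain hs
  obtain ⟨h0, hb1, hb2, hb3, hb4, hb5, hb6, hb7, hc1⟩ := box hb
  have hp0 : (0 : ℤ) < p := by exact_mod_cast hp
  have one : ∀ z : ℤ, (p : ℤ) ≤ z → z ≤ 2 * (p : ℤ) - 1 → z / (p : ℤ) = 1 := fun z h1 h2 => by
    rw [Int.ediv_eq_iff_of_pos hp0]; constructor <;> linarith
  have z12 : (b 0 - b 1 - b 2) / (p : ℤ) = 0 := Int.ediv_eq_zero_of_lt (by linarith) (by linarith)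
  have z13 : (b 0 - b 1 - b 3) / (p : ℤ) = 0 := Int.ediv_eq_zero_of_lt (by linarith) (by linarith)
  have z14 : (b 0 - b 1 - b 4) / (p : ℤ) = 0 := Int.ediv_eq_zero_of_lt (by linarith) (by linarith)
  have z15 : (b 0 - b 1 - b 5) / (p : ℤ) = 0 := Int.ediv_eq_zero_of_lt (by linarith) (by linarith)
  have z16 : (b 0 - b 1 - b 6) / (p : ℤ) = 0 := Int.ediv_eq_zero_of_lt (by linarith) (by linarith)
  have z23 : (b 0 - b 2 - b 3) / (p : ℤ) = 0 := Int.ediv_eq_zero_of_lt (by linarith) (by linarith)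
  have z24 : (b 0 - b 2 - b 4) / (p : ℤ) = 0 := Int.ediv_eq_zero_of_lt (by linarith) (by linarith)
  have z25 : (b 0 - b 2 - b 5) / (p : ℤ) = 0 := Int.ediv_eq_zero_of_lt (by linarith) (by linarith)
  have z26 : (b 0 - b 2 - b 6) / (p : ℤ) = 0 := Int.ediv_eq_zero_of_lt (by linarith) (by linarith)
  have z34 : (b 0 - b 3 - b 4) / (p : ℤ) = 0 := Int.ediv_eq_zero_of_lt (by linarith) (by linarith)
  have z35 : (b 0 - b 3 - b 5) / (p : ℤ) = 0 := Int.ediv_eq_zero_of_lt (by linarith) (by linarith)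
  have z36 : (b 0 - b 3 - b 6) / (p : ℤ) = 0 := Int.ediv_eq_zero_of_lt (by linarith) (by linarith)
  have U := fun (i k : ℕ) (hi : i < 7) (hk : k < 7) (hik : i < k) => firstPeriod_pair hfp hi hk hik
  rw [pairFloors_expand, z12, z13, z14, z15, z16, z23, z24, z25, z26, z34, z35, z36,
    one _ (by linarith) (U 0 6 (by norm_num) (by norm_num) (by norm_num)),
    one _ (by linarith) (U 1 6 (by norm_num) (by norm_num) (by norm_num)),
    one _ (by linarith) (U 2 6 (by norm_num) (by norm_num) (by norm_num)),
    one _ (by linarith) (U 3 4 (by norm_num) (by norm_num) (by norm_num)),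
    one _ (by linarith) (U 3 5 (by norm_num) (by norm_num) (by norm_num)),
    one _ (by linarith) (U 3 6 (by norm_num) (by norm_num) (by norm_num)),
    one _ (by linarith) (U 4 5 (by norm_num) (by norm_num) (by norm_num)),
    one _ (by linarith) (U 4 6 (by norm_num) (by norm_num) (by norm_num)),
    one _ (by linarith) (U 5 6 (by norm_num) (by norm_num) (by norm_num))]
  norm_num

/-- **The V-GAIN law on this profile, general `b`, every depth**: `v_p(Cas_j(b)) ≥ -5`, and `≥ -5` for `p ≤ d` — gen 10's `checkB` at `N = 6`
(the only non-tame classes of exponent `≤ −6` are centre-free palindromic classes at `−6`) and the row check at `R = 0` hold on both covers (`decide`);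
gen 23's `DenomLaw.vgainPal_of_cover` (the same `V`-bounds, THEOREM LB♯'s palindromic rows: a dropped deep palindromic multipole class contributes `4 + E`). -/
theorem cas_geA6u47 (hb : InPolytope b) (hs : Sorted7 b) (hbj : InPolytope (shift b j)) (hj1 : 1 ≤ j) (hj7 : j ≤ 7)
    (hprime : p.Prime) (hp5 : 5 ≤ p) (hwin : (b 0 + 2 : ℤ) < (p : ℤ) ^ 2) (hA : b 7 < (p : ℤ)) (hA6 : (p : ℤ) ≤ b 6) (hQ17 : (p : ℤ) + b 1 + b 7 ≤ b 0) (hQ45 : (p : ℤ) + b 4 + b 5 ≤ b 0) (hQ : b 0 < (p : ℤ) + b 3 + b 6)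
    (hF1 : b 1 < 2 * (p : ℤ)) (hF2 : b 0 < 2 * (p : ℤ) + b 6 + b 7) (hcas : casoratian b j ≠ 0) :
    -5 + (if (p : ℤ) ≤ dOf b then (0 : ℤ) else 0) ≤ padicValRat p (casoratian b j) := by
  haveI : Fact p.Prime := ⟨hprime⟩
  have hp2 : p % 2 = 1 := Nat.odd_iff.1 (hprime.odd_of_ne_two (by omega))
  obtain ⟨h21, h32, h43, h54, h65, h76⟩ := sorted7_chain hs
  obtain ⟨h0, hb1, hb2, hb3, hb4, hb5, hb6, hb7, hc1⟩ := box hb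
  have hpb : (p : ℤ) ≤ b 0 := by linarith
  have hmin : min (0 : ℤ) 0 = 0 := by norm_num
  rcases Int.emod_two_eq_zero_or_one (b 0) with hr | hr
  · have h := vgainPal_of_cover hb hj1 hj7 hbj hp5 hpb hwin (coverA6U47_ev hb hs hA hA6 hQ17 hQ45 hQ hF1 hF2 hp5 hp2 hr) (N := 6) (by norm_num) ⟨3, rfl⟩
      (by rw [oddFlag_false hr]; decide) 0 (by norm_num) (by rw [oddFlag_false hr]; decide) hcas
    rw [hmin] at h; push_cast at h; split_ifs at h ⊢ <;> linarith
  · have h := vgainPal_of_cover hb hj1 hj7 hbj hp5 hpb hwin (coverA6U47_od hb hs hA hA6 hQ17 hQ45 hQ hF1 hF2 hp5 hp2 hr) (N := 6) (by norm_num) ⟨3, rfl⟩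
      (by rw [oddFlag_true hr]; decide) 0 (by norm_num) (by rw [oddFlag_true hr]; decide) hcas
    rw [hmin] at h; push_cast at h; split_ifs at h ⊢ <;> linarith

/-- **`PathAccountingFirstPeriod`'s conclusion on this a = 6 profile (long pair blocks `(i,7)`, `i ≤ 6`, and the pairs within `{4,5,6}`), EVERY sorted `b`, every direction `j`, depth `d < 2p`**
(`N_p = 9`, `C⋆ ≤ 8`; the node asks `-6` at `⌊d/p⌋ = 0` and `-5` at `⌊d/p⌋ = 1`; the depth `⌊d/p⌋ = 2` is NOT covered here). -/
theorem pathAccounting_profileA6u47 (b : ℕ → ℤ) (j p : ℕ) (hb : InPolytope b) (hs : Sorted7 b) (hbj : InPolytope (shift b j))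
    (hj1 : 1 ≤ j) (hj7 : j ≤ 7) (hprime : p.Prime) (hp5 : 5 ≤ p) (hwin : (b 0 + 2 : ℤ) < (p : ℤ) ^ 2) (hfp : FirstPeriod b p)
    (hA : b 7 < (p : ℤ)) (hA6 : (p : ℤ) ≤ b 6) (hQ17 : (p : ℤ) + b 1 + b 7 ≤ b 0) (hQ45 : (p : ℤ) + b 4 + b 5 ≤ b 0) (hQ : b 0 < (p : ℤ) + b 3 + b 6) (hd2 : dOf b < 2 * (p : ℤ))
    (hcas : casoratian b j ≠ 0) :
    dOf b / (p : ℤ) - pairFloors b p - min (if 2 ≤ dOf b / (p : ℤ) then (1 : ℤ) else 0) (5 - (cStar b p : ℤ))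
      ≤ padicValRat p (casoratian b j) := by
  obtain ⟨hF1, hF2⟩ := fp_bounds hfp
  have hp0 : (0 : ℤ) < p := by exact_mod_cast hprime.pos
  rw [pairFloors_eq_A6u47 hb hs hprime.pos hQ17 hQ45 hQ hfp]
  have hC : (cStar b p : ℤ) ≤ 8 := by exact_mod_cast cStar_le_eight_A6u47 hs hA hQ
  have hfd : dOf b / (p : ℤ) < 2 := by rw [Int.ediv_lt_iff_lt_mul hp0]; linarith
  rw [if_neg (by omega)]
  have hmin : -3 ≤ min (0 : ℤ) (5 - (cStar b p : ℤ)) := le_min (by norm_num) (by linarith)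
  have hlaw := cas_geA6u47 hb hs hbj hj1 hj7 hprime hp5 hwin hA hA6 hQ17 hQ45 hQ hF1 hF2 hcas
  by_cases h1 : (p : ℤ) ≤ dOf b
  · have hfd1 : dOf b / (p : ℤ) ≤ 1 := by omega
    rw [if_pos h1] at hlaw
    linarith
  · rw [if_neg h1] at hlaw
    push Not at h1
    have hd0 : 0 ≤ dOf b := by have := hb.2.2; unfold dOf; linarith
    have hfd0 : dOf b / (p : ℤ) = 0 := Int.ediv_eq_zero_of_lt hd0 h1
    rw [hfd0]
    linarith

/-- **THE NODE ON THIS a = 6 PROFILE AT DEPTH `d < 2p`, EVERY SORTED `b`: `PathAccountingFirstPeriod` with its binders VERBATIM plus `b₇ < p ≤ b₆`, the profile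
inequalities and `d < 2p`.** -/
theorem pathAccountingFirstPeriod_profileA6u47 :
    ∀ (b : ℕ → ℤ) (p : ℕ), InPolytope b → Sorted7 b → InPolytope (shift b 7) →
      p.Prime → 5 ≤ p → (b 0 + 2 : ℤ) < (p : ℤ) ^ 2 → FirstPeriod b p →
      b 7 < (p : ℤ) → (p : ℤ) ≤ b 6 → (p : ℤ) + b 1 + b 7 ≤ b 0 → (p : ℤ) + b 4 + b 5 ≤ b 0 → b 0 < (p : ℤ) + b 3 + b 6 → dOf b < 2 * (p : ℤ) → casoratian b 7 ≠ 0 →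
        dOf b / (p : ℤ) - pairFloors b p - min (if 2 ≤ dOf b / (p : ℤ) then (1 : ℤ) else 0) (5 - (cStar b p : ℤ))
          ≤ padicValRat p (casoratian b 7) :=
  fun b p hb hs hb7 hprime hp5 hwin hfp hA hA6 hQ17 hQ45 hQ hd2 hcas =>
    pathAccounting_profileA6u47 b 7 p hb hs hb7 (by norm_num) (by norm_num) hprime hp5 hwin hfp hA hA6 hQ17 hQ45 hQ hd2 hcas

end A6U47

end Summit.KontsevichZagierPeriods.Zeta5Search.FullProfile
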